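import Mathlib
import Summits.Ventures.PercRepro2.Defs
import Summits.Ventures.PercRepro2.Independence
import Summits.Ventures.PercRepro2.Harris
import Summits.Ventures.PercRepro2.Graph
import Summits.Ventures.PercRepro2.Exploration
import Summits.Ventures.PercRepro2.Events
import Summits.Ventures.PercRepro2.Induced
import Summits.Ventures.PercRepro2.Frontier
import Summits.Ventures.PercRepro2.ObsIndependence
import Summits.Ventures.PercRepro2.BHK
import Summits.Ventures.PercRepro2.BHKEvents
import Summits.Ventures.PercRepro2.BHKAvoid

/-!
# The cross-cluster inequality for FUNCTIONALS, with set avoidance (blind cell PercRepro2, p4 g14)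

BHK06 Thm 1.4 in functional form, with a set `X ∋ t` avoided by the root `s`: for a monotone
nonnegative functional `F₁` of the cluster `C_s` and an ANTITONE nonnegative functional `Ψ` of the
cluster `C_t`,

  `E[F₁(C_s) 1_{s↮X}] · E[Ψ(C_t) 1_{s↮X}] ≤ E[F₁(C_s) Ψ(C_t) 1_{s↮X}] · P(s ↮ X)`

(`bhk_cross_functional_avoid`): under `P(· | s ↮ X)` an increasing functional of `C_s` and a decreasing
functional of `C_t` are positively correlated.  The event version (`bhk_cross_cluster_avoid`, `Ψ = 1 − 1_𝓥`)
is the case of indicators.  Same proof: explore `C_s`; on `{s ↮ X}` the cluster of `t` is its cluster in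
`G ∖ C_s`, so `E[F₁(C_s) Ψ(C_t) 1_{s↮X}] = E[F₁(C_s) · G(C_s) · 1_{s↮X}]` with `G(W) = E[Ψ(C_t) in G ∖ W]`
(`expect_cross_avoid_eq`, the tower identity with a functional in place of the indicator `1_𝓥`); `G` is
monotone in `W` (`delExpect_clusterFn_mono_of_antitone`: a decreasing functional of a cluster that shrinks with `W`),
and the same-cluster functional inequality `bhk_induced` (`X = Y`, `F₂ = G`) closes.  No definitions:
`G` is the tree's `delExpect`.
-/

namespace Summit.Ventures.PercRepro2

section CrossFunctional

variable {V : Type*} {E : Type*} [Fintype E] [DecidableEq E] [Fintype V] [DecidableEq V]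
  {R : Type*} [CommRing R] [LinearOrder R] [IsStrictOrderedRing R]

omit [Fintype E] [DecidableEq E] [Fintype V] [DecidableEq V] in
/-- `delConfig` with nothing deleted is the identity. -/
lemma delConfig_empty_eq_self (ends : E → Sym2 V) (ω : Config E) : delConfig ends (∅ : Set V) ω = ω := by
  funext e
  have : e ∉ touches ends (∅ : Set V) := by
    rintro ⟨x, hx, _⟩
    exact hx
  rw [delConfig_apply_of_notMem this]

omit [Fintype V] [DecidableEq V] [LinearOrder R] [IsStrictOrderedRing R] in
/-- `delExpect` of a cluster functional, unfolded. -/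
lemma delExpect_clusterFn_apply (p : E → R) (ends : E → Sym2 V) (Ψ : Set V → R) (t : V) (W : Set V) :
    delExpect p ends (fun t ω => Ψ (cluster ends ω t)) t W =
      expect p (fun ω => Ψ (cluster ends (delConfig ends W ω) t)) := rfl

omit [Fintype V] [DecidableEq V] in
/-- For an antitone functional `Ψ`, `W ↦ E[Ψ(C_t) in G ∖ W]` is monotone. -/
lemma delExpect_clusterFn_mono_of_antitone (p : E → R) (hp : IsProbVec p) (ends : E → Sym2 V) (t : V)
    {Ψ : Set V → R} (hΨ : Antitone Ψ) :
    Monotone (delExpect p ends (fun t ω => Ψ (cluster ends ω t)) t) := by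
  intro W W' h
  rw [delExpect_clusterFn_apply, delExpect_clusterFn_apply]
  unfold expect
  refine Finset.sum_le_sum fun ω _ => ?_
  refine mul_le_mul_of_nonneg_left ?_ (weight_nonneg hp ω)
  exact hΨ (cluster_mono (delConfig_anti h ω) t)

omit [Fintype V] [DecidableEq V] in
/-- For a nonnegative functional `Ψ`, `E[Ψ(C_t) in G ∖ W] ≥ 0`. -/
lemma delExpect_clusterFn_nonneg (p : E → R) (hp : IsProbVec p) (ends : E → Sym2 V) (t : V)
    {Ψ : Set V → R} (hΨ0 : ∀ S, 0 ≤ Ψ S) (W : Set V) :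
    0 ≤ delExpect p ends (fun t ω => Ψ (cluster ends ω t)) t W := by
  rw [delExpect_clusterFn_apply]
  unfold expect
  exact Finset.sum_nonneg fun ω _ => mul_nonneg (weight_nonneg hp ω) (hΨ0 _)

omit [DecidableEq V] [LinearOrder R] [IsStrictOrderedRing R] in
/-- **Exploring the cluster of `s` under set avoidance, functional form**: for `t ∈ X` and functionals
`F₁` (of `C_s`) and `Ψ` (of `C_t`),
`E[F₁(C_s) · Ψ(C_t) · 1_{s↮X}] = E[F₁(C_s) · G(C_s) · 1_{s↮X}]` with `G(W) = E[Ψ(C_t) in G ∖ W]`. -/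
theorem expect_cross_avoid_eq (p : E → R) (ends : E → Sym2 V) (s t : V)
    {X : Finset V} (ht : t ∈ X) (F₁ Ψ : Set V → R) :
    expect p (fun ω => F₁ (cluster ends ω s) * Ψ (cluster ends ω t) *
        (avoidAll ends s X).indicator 1 ω) =
      expect p (fun ω => F₁ (cluster ends ω s) *
        delExpect p ends (fun t ω => Ψ (cluster ends ω t)) t (cluster ends ω s) *
        (avoidAll ends s X).indicator 1 ω) := by
  classical
  let 𝓐 : Set (Set V) := {W | ∀ x ∈ X, x ∉ W}
  have hA : ∀ ω, ω ∈ avoidAll ends s X ↔ cluster ends ω s ∈ 𝓐 := fun ω => Iff.rfl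
  let c : Set V → R := fun W => F₁ W * 𝓐.indicator 1 W
  let D : Set V → Config E → R := fun W ω => Ψ (cluster ends (delConfig ends W ω) t)
  let Φ : Set V → Config E → R := fun W ω => c W * D W ω
  have hΦ : ∀ W, DependsOn (Φ W) (touches ends W)ᶜ := by
    intro W ω ω' h
    simp only [Φ, D]
    congr 2
    rw [delConfig_congr h]
  have hS : ∀ W : Set V, DependsOn (· ∈ {ω | cluster ends ω s = W}) (touches ends W) :=
    fun W => dependsOn_clusterEvent ends s W
  have hdisj : ∀ W : Set V, Disjoint (touches ends W) (touches ends W)ᶜ :=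
    fun W => disjoint_compl_right
  have hpt : ∀ ω, F₁ (cluster ends ω s) * Ψ (cluster ends ω t) *
      (avoidAll ends s X).indicator (1 : Config E → R) ω = Φ (cluster ends ω s) ω := by
    intro ω
    simp only [Φ, c, D]
    by_cases hav : ω ∈ avoidAll ends s X
    · have hst : t ∉ cluster ends ω s := notMem_cluster_of_mem_avoidAll ht hav
      have e := cluster_delConfig_cluster (ends := ends) (ω := ω) (s := s) hst
      rw [Set.indicator_of_mem (show cluster ends ω s ∈ 𝓐 from (hA ω).1 hav),
        Set.indicator_of_mem hav, e]
      simp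
    · rw [Set.indicator_of_notMem (show cluster ends ω s ∉ 𝓐 from fun h => hav ((hA ω).2 h)),
        Set.indicator_of_notMem hav]
      simp
  have hΦexp : ∀ W, expect p (Φ W) =
      c W * delExpect p ends (fun t ω => Ψ (cluster ends ω t)) t W := by
    intro W
    simp only [Φ, D]
    rw [expect_const_mul]
    rfl
  have e1 : (fun ω => F₁ (cluster ends ω s) * Ψ (cluster ends ω t) *
      (avoidAll ends s X).indicator (1 : Config E → R) ω) = fun ω => Φ (cluster ends ω s) ω :=
    funext hpt
  rw [e1, expect_tower p hdisj (S := fun ω => cluster ends ω s) hS hΦ]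
  simp only [hΦexp]
  unfold expect
  refine Finset.sum_congr rfl fun ω _ => ?_
  simp only [c]
  by_cases hav : ω ∈ avoidAll ends s X
  · rw [Set.indicator_of_mem (show cluster ends ω s ∈ 𝓐 from (hA ω).1 hav),
      Set.indicator_of_mem hav]
    simp
  · rw [Set.indicator_of_notMem (show cluster ends ω s ∉ 𝓐 from fun h => hav ((hA ω).2 h)),
      Set.indicator_of_notMem hav]
    simp

/-- **BHK06 Thm 1.4, functional form with set avoidance** (`X ∋ t`): for a monotone nonnegative
functional `F₁` of `C_s` and an antitone nonnegative functional `Ψ` of `C_t`,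
`E[F₁(C_s) 1_{s↮X}] · E[Ψ(C_t) 1_{s↮X}] ≤ E[F₁(C_s) Ψ(C_t) 1_{s↮X}] · P(s ↮ X)`. -/
theorem bhk_cross_functional_avoid (p : E → R) (hp : IsProbVec p) (ends : E → Sym2 V) (s t : V)
    {X : Finset V} (ht : t ∈ X) {F₁ Ψ : Set V → R} (hF₁ : Monotone F₁) (hF₁0 : ∀ S, 0 ≤ F₁ S)
    (hΨ : Antitone Ψ) (hΨ0 : ∀ S, 0 ≤ Ψ S) :
    expect p (fun ω => F₁ (cluster ends ω s) * (avoidAll ends s X).indicator 1 ω) *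
        expect p (fun ω => Ψ (cluster ends ω t) * (avoidAll ends s X).indicator 1 ω) ≤
      expect p (fun ω => F₁ (cluster ends ω s) * Ψ (cluster ends ω t) *
          (avoidAll ends s X).indicator 1 ω) * prob p (avoidAll ends s X) := by
  classical
  set G := delExpect p ends (fun t ω => Ψ (cluster ends ω t)) t with hG
  have hGmono : Monotone G := delExpect_clusterFn_mono_of_antitone p hp ends t hΨ
  have hG0 : ∀ W, 0 ≤ G W := delExpect_clusterFn_nonneg p hp ends t hΨ0
  have key := bhk_induced p hp ends s hF₁ hGmono hF₁0 hG0 Finset.univ X X (Finset.subset_univ _)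
    (Finset.subset_univ _)
  simp only [Finset.inter_self, Finset.union_self, REvent_univ] at key
  have e : ∀ F : Set V → R, clusterObs ends Finset.univ s F * (avoidAll ends s X).indicator 1 =
      fun ω => F (cluster ends ω s) * (avoidAll ends s X).indicator 1 ω := by
    intro F
    funext ω
    simp only [Pi.mul_apply, clusterObs_apply, clusterIn_univ]
  rw [e, e, e] at key
  simp only [Pi.mul_apply] at key
  -- the two tower identities: `F₁ = 1` and `F₁` itself
  have t1 := expect_cross_avoid_eq p ends s t ht (fun _ => (1 : R)) Ψ
  have t2 := expect_cross_avoid_eq p ends s t ht F₁ Ψ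
  simp only [one_mul] at t1
  rw [t1, t2]
  exact key

end CrossFunctional

end Summit.Ventures.PercRepro2
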